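import Literature.Probability.LatticeModels.VillainVorticity
import HarnessLib

/-!
# Real edge fields of the cube with grounded boundary: `range T = {flat} ∩ {zero on shell edges}`

Companion of `VillainVorticity.lean` (integer edge fields) for the named fact
`Literature.Probability.LatticeModels.FrohlichSpencerVillainSpinWaveBound`: the same structure
theorem over `ℝ`, i.e. for the linear map `T = gradR n : ℝ^{□°} → ℝ^{E(□)}` of the duality
(`VillainSpinWaveDuality.lean`) — the exactness `range T = ker(curl) ∩ ker(shell restriction)`
(`d ≥ 2`) that the tree's Coulomb-gas algebra (`CoulombGasAlgebra`: `KerEqRange T D`, FS82 (2.35))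
takes as input one degree up. Proof: Poincaré lemma on the box with real coefficients
(`LatticeForm.exists_d₀_eq_of_flat_on_box`) and connectivity of the shell (`shell_const`).

* `extE_gradR_of_mem` — `extE (Tθ) = d₀ θ̄` on the cube; `d₁_extE_gradR_eq_zero` — `Tθ` is flat;
* **`mem_range_gradR_iff`** — `w ∈ range T ↔ (d₁ (extE w) = 0 on the cube's plaquettes) ∧ (w = 0 on
  shell edges)`; `exists_gMat_mulVec_eq_iff` — the same in matrix (`gMat`) form.

Theorems only; no definition and no named fact is introduced.

## References

* [FrohlichSpencerCMP1982] J. Fröhlich, T. Spencer, Comm. Math. Phys. 83 (1982) 411–454, §2.3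
  Lemma 1, §2.5 (2.35).
* [ForsstromLenellsViklund2022] M. P. Forsström, J. Lenells, F. Viklund, AIHP 58 (2022), §2 Lemma 2.2.
-/

noncomputable section

open Finset Function Set Matrix

namespace Literature.Probability.LatticeModels

namespace DirichletVillain

open Literature.MathematicalPhysics.QuantumFieldTheory
open Literature.MathematicalPhysics.QuantumFieldTheory.LatticeForm (e d₀ d₁ d₁_d₀)

variable {d : ℕ} {n : ℕ}

/-- `extE (Tθ) (x, i) = d₀ θ̄ (x, i)` on the edges of the cube. [folklore] -/
theorem extE_gradR_of_mem (θ : SIdx d n → ℝ) {x : Site d} {i : Fin d} (h : (x, i) ∈ cubeEdges d n) :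
    extE n (gradR n θ) x i = d₀ (dirichletExtend n θ) x i := by
  rw [extE_of_mem _ h, gradR_apply, LatticeForm.d₀]

/-- **`Tθ` is flat**: `d₁ (extE (Tθ)) = 0` on every plaquette of the cube. [folklore] -/
theorem d₁_extE_gradR_eq_zero (θ : SIdx d n → ℝ) {x : Site d} {i j : Fin d}
    (hx : x ∈ box d (n + 1)) (hxij : x + e i + e j ∈ box d (n + 1)) :
    d₁ (extE n (gradR n θ)) x i j = 0 := by
  obtain ⟨h1, h2, h3, h4⟩ := plaquette_edges_mem (n := n) hx hxij
  rw [d₁_congr_plaquette (extE_gradR_of_mem θ h1) (extE_gradR_of_mem θ h3)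
    (extE_gradR_of_mem θ h4) (extE_gradR_of_mem θ h2), d₁_d₀]
  rfl

/-- **Real edge fields: `range T` = flat fields vanishing on the shell edges** (`d ≥ 2`;
`T = gradR n`). The exactness input (`ker curl = range T` once the shell edges are discarded) of
the Coulomb-gas algebra, FS82 (2.35), for the spin model one degree below the gauge theory.
[cite: FrohlichSpencerCMP1982, §2.3 Lemma 1, §2.5 (2.35)] -/
theorem mem_range_gradR_iff (hd : 2 ≤ d) (w : EIdx d n → ℝ) :
    w ∈ LinearMap.range (gradR (d := d) n) ↔
      (∀ (x : Site d) (i j : Fin d), x ∈ box d (n + 1) → x + e i + e j ∈ box d (n + 1) →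
          d₁ (extE n w) x i j = 0) ∧
        ∀ e' : EIdx d n, e'.1.1 ∉ box d n → e'.1.1 + e e'.1.2 ∉ box d n → w e' = 0 := by
  constructor
  · rintro ⟨θ, rfl⟩
    refine ⟨fun x i j hx hxij => d₁_extE_gradR_eq_zero θ hx hxij, fun e' h1 h2 => ?_⟩
    rw [gradR_apply, dirichletExtend_of_not_mem _ h2, dirichletExtend_of_not_mem _ h1, sub_zero]
  · rintro ⟨hflat, hshell⟩
    obtain ⟨g, hg⟩ := LatticeForm.exists_d₀_eq_of_flat_on_box (extE n w)
      (-((n + 1 : ℕ) : Site d)) ((n + 1 : ℕ) : Site d) (fun x i j hx hxij =>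
        hflat x i j (mem_box_iff_mem_Icc.2 hx) (mem_box_iff_mem_Icc.2 hxij))
    have hg' : ∀ (x : Site d) (i : Fin d), (x, i) ∈ cubeEdges d n → g (x + e i) - g x = extE n w x i :=
      fun x i h => hg x i (mem_box_iff_mem_Icc.1 (mem_cubeEdges.1 h).1)
        (mem_box_iff_mem_Icc.1 (mem_cubeEdges.1 h).2)
    have hgshell : ∀ (x : Site d) (i : Fin d), (x, i) ∈ cubeEdges d n → x ∉ box d n →
        x + e i ∉ box d n → g (x + e i) = g x := by
      intro x i h h1 h2
      have h3 := hg' x i h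
      rw [extE_of_mem _ h, hshell ⟨(x, i), h⟩ h1 h2] at h3
      exact sub_eq_zero.1 h3
    set c : ℝ := g (fun _ => (n : ℤ) + 1) with hc
    have hgc : ∀ y : Site d, y ∈ box d (n + 1) → y ∉ box d n → g y = c := fun y hy1 hy0 =>
      shell_const hd hgshell hy1 hy0
    refine ⟨fun a => g a - c, funext fun e' => ?_⟩
    have hext : ∀ y : Site d, y ∈ box d (n + 1) →
        dirichletExtend n (fun a : SIdx d n => g a - c) y = g y - c := by
      intro y hy
      by_cases hy0 : y ∈ box d n
      · rw [dirichletExtend_of_mem _ hy0]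
      · rw [dirichletExtend_of_not_mem _ hy0, hgc y hy hy0, sub_self]
    obtain ⟨h1, h2⟩ := mem_cubeEdges.1 e'.2
    rw [gradR_apply, hext _ h2, hext _ h1, sub_sub_sub_cancel_right, hg' _ _ e'.2, extE_apply]

/-- Matrix form: `(∃ θ, T θ = w) ↔ flat ∧ zero on shell edges` (`T = gMat n`, `d ≥ 2`). [folklore] -/
theorem exists_gMat_mulVec_eq_iff (hd : 2 ≤ d) (w : EIdx d n → ℝ) :
    (∃ θ : SIdx d n → ℝ, gMat n *ᵥ θ = w) ↔
      (∀ (x : Site d) (i j : Fin d), x ∈ box d (n + 1) → x + e i + e j ∈ box d (n + 1) →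
          d₁ (extE n w) x i j = 0) ∧
        ∀ e' : EIdx d n, e'.1.1 ∉ box d n → e'.1.1 + e e'.1.2 ∉ box d n → w e' = 0 := by
  rw [← mem_range_gradR_iff hd w, LinearMap.mem_range]
  simp only [gMat_mulVec]

end DirichletVillain

end Literature.Probability.LatticeModels
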